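import Literature.NumberTheory.Weil1965.ThetaIntegralOrbitFunctionalUnitary
import Literature.NumberTheory.Weil1965.AdelicFibreMeasuresCutoff
import Literature.MeasureTheory.Group.QuotientAveraging
import Mathlib.Analysis.Normed.Group.Tannery
import HarnessLib

/-!
# The theta-side orbit functional is continuous along cut-offs (its tightness: `Λ` IS its Radon measure)

Topic `NumberTheory/Weil1965`; namespace `Literature.NumberTheory.Weil1965`.  KERNEL MATHEMATICS ONLY: proved theorems,
no definition, no named fact, no `sorry`.  Sequel of ★ `ThetaIntegralOrbitFunctional` (the positive functional
`Λ(Φ) = ∫_{G/Γ} Σ'_{ξ ≠ 0} Φ(A(g) ξ) dν` of a geometric action on `𝒮(𝔸_F^m)`), companion of ★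
`AdelicFibreMeasuresCutoff` §2 (p06): there, `∫ Ψ dν_S = S Ψ` for the Radon measure `ν_S` of a positive functional `S` on
`𝒮_ℝ(𝔸_F^ι)` follows from the ONE hypothesis «`S(Ψ c_n) → S(Ψ)` along cut-offs `0 ≤ c_n ≤ 1`, `c_n → 1`»
(`integral_schwartzBruhatMeasure_eq_of_tendsto_cutoff`).  This file proves that hypothesis for `S = Λ_ℝ`, the real orbit
functional — Weil's "convergence uniforme sur toute partie compacte" for the theta side [Weil1965, Chap. I n° 2,
Lemme 5; Chap. IV n° 41]: Tannery's theorem in the fibre (dominated by `Σ |Ψ(A g ξ)|`) and dominated convergence on the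
compact quotient (dominated by ONE constant: the uniform summable majorant of ★ `exists_summable_majorant_of_isCompact` on a
compact set of representatives, ★ `WeilQuotient.exists_isCompact_image_mk_superset`).
* `norm_orbitSum_le_tsum`, `exists_orbitSumQuot_bound` — `|Σ'_{ξ≠0} (Ψ·c)(A g ξ)| ≤ Σ' u` uniformly in `g` and in the
  cut-off `c` (`|c| ≤ 1`);
* `tendsto_orbitSum_mul` — Tannery in the fibre; `tendsto_orbitFunctional_mul`, **`tendsto_orbitFunctionalReal_mul`** — the
  cut-off continuity of `Λ` ∕ `Λ_ℝ` (the `ht` of ★ `integral_schwartzBruhatMeasure_eq_of_tendsto_cutoff`);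
* **`integral_schwartzBruhatMeasure_orbitFunctionalReal_eq`** — `Ψ ≥ 0 ⇒ Ψ ∈ L¹(ν_{Λ_ℝ})` and `∫ Ψ dν_{Λ_ℝ} = Λ_ℝ(Ψ)`
  (with p06's tensor cut-offs ★ `exists_tensor_cutoff`);
* §2 the dual-pair instance `A := vDiagAct` of ★ `ThetaIntegralOrbitFunctionalUnitary`, `S := thetaOrbitFunctionalReal ν`:
  `tendsto_thetaOrbitFunctionalReal_mul`, **`integral_schwartzBruhatMeasure_thetaOrbitFunctionalReal_eq`**.

## References
* [Weil1965] A. Weil, *Sur la formule de Siegel dans la théorie des groupes classiques*, Acta Math. 113 (1965): Chap. I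
  n° 2, Lemmes 2–5 pp. 7–9; Chap. IV n° 41 p. 59.
* [Weil1964] A. Weil, Acta Math. 111 (1964), Chap. III n° 41, Lemme 5 p. 192 (uniform majorants on compacta).
-/

set_option autoImplicit false

noncomputable section

namespace Literature.NumberTheory.Weil1965

open Literature.NumberTheory.Automorphic Literature.NumberTheory.Weil1964
open NumberField _root_.MeasureTheory Filter _root_.Topology
open scoped Matrix

section Cutoff

variable (F : Type) [Field F] [NumberField F] {m : ℕ}
variable {G : Type*} [Group G] [TopologicalSpace G] [IsTopologicalGroup G] [LocallyCompactSpace G]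
variable (Γ : Subgroup G) [CompactSpace (G ⧸ Γ)] [MeasurableSpace (G ⧸ Γ)] [BorelSpace (G ⧸ Γ)]
variable (ν : Measure (G ⧸ Γ)) [IsFiniteMeasure ν]
variable (A : G →* ((Fin m → AdeleRing (𝓞 F) F) ≃ₗ[AdeleRing (𝓞 F) F] (Fin m → AdeleRing (𝓞 F) F)))
variable (hA : ∀ x : Fin m → AdeleRing (𝓞 F) F, Continuous fun g => A g x)
variable (hΓ : ∀ γ ∈ Γ, ∀ ξ : Fin m → F, ∃ ξ' : Fin m → F, A γ (ratPt F (Fin m) ξ) = ratPt F (Fin m) ξ')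

omit [TopologicalSpace G] [IsTopologicalGroup G] [LocallyCompactSpace G] [CompactSpace (G ⧸ Γ)] [MeasurableSpace (G ⧸ Γ)]
  [BorelSpace (G ⧸ Γ)] in
/-- **the orbit sum of a damped function is dominated by the undamped absolute series**: for `|c| ≤ 1`,
`‖Σ'_{ξ≠0} (Φ·c)(A g ξ)‖ ≤ Σ'_{ξ ∈ F^m} ‖Φ(A g ξ)‖`. [cite: Weil1965, Chap. I n° 2, Lemme 5, p. 9] -/
theorem norm_orbitSum_mul_le_tsum {Φ : (Fin m → AdeleRing (𝓞 F) F) → ℂ} (hΦ : Φ ∈ piSchwartzBruhat F (Fin m)) (c : (Fin m → AdeleRing (𝓞 F) F) → ℂ)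
    (hc : ∀ x, ‖c x‖ ≤ 1) (g : G) :
    ‖orbitSum F A (fun x => Φ x * c x) g‖ ≤ ∑' ξ : Fin m → F, ‖Φ (A g (ratPt F (Fin m) ξ))‖ := by
  have hs : Summable fun ξ : Fin m → F => ‖Φ (A g (ratPt F (Fin m) ξ))‖ := summable_norm_apply_ratPt A hΦ g
  have hterm : ∀ ξ : NonzeroRat F m, ‖Φ (A g (ratPt F (Fin m) (ξ : Fin m → F))) * c (A g (ratPt F (Fin m) (ξ : Fin m → F)))‖ ≤
      ‖Φ (A g (ratPt F (Fin m) (ξ : Fin m → F)))‖ := fun ξ => by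
    rw [norm_mul]
    exact mul_le_of_le_one_right (norm_nonneg _) (hc _)
  have hs' : Summable fun ξ : NonzeroRat F m => ‖Φ (A g (ratPt F (Fin m) (ξ : Fin m → F)))‖ := hs.subtype _
  have hsm : Summable fun ξ : NonzeroRat F m =>
      ‖Φ (A g (ratPt F (Fin m) (ξ : Fin m → F))) * c (A g (ratPt F (Fin m) (ξ : Fin m → F)))‖ :=
    hs'.of_nonneg_of_le (fun _ => norm_nonneg _) hterm
  calc ‖orbitSum F A (fun x => Φ x * c x) g‖
      ≤ ∑' ξ : NonzeroRat F m, ‖Φ (A g (ratPt F (Fin m) (ξ : Fin m → F))) * c (A g (ratPt F (Fin m) (ξ : Fin m → F)))‖ :=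
        norm_tsum_le_tsum_norm hsm
    _ ≤ ∑' ξ : NonzeroRat F m, ‖Φ (A g (ratPt F (Fin m) (ξ : Fin m → F)))‖ := hsm.tsum_le_tsum hterm hs'
    _ ≤ ∑' ξ : Fin m → F, ‖Φ (A g (ratPt F (Fin m) ξ))‖ :=
        Summable.tsum_subtype_le (fun ξ : Fin m → F => ‖Φ (A g (ratPt F (Fin m) ξ))‖) _ (fun _ => norm_nonneg _) hs

include hA in
omit [MeasurableSpace (G ⧸ Γ)] [BorelSpace (G ⧸ Γ)] in
/-- **ONE constant dominating all damped orbit sums on the quotient**: there is `M` with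
`‖orbitSumQuot (Φ·c) q‖ ≤ M` for every `q ∈ G ⧸ Γ` and every `|c| ≤ 1` (a compact set of representatives ★
`exists_isCompact_image_mk_superset` and the uniform majorant ★ `exists_summable_majorant_of_isCompact`).
[cite: Weil1964, Chap. III n° 41, Lemme 5 p. 192] -/
theorem exists_orbitSumQuot_mul_bound {Φ : (Fin m → AdeleRing (𝓞 F) F) → ℂ} (hΦ : Φ ∈ piSchwartzBruhat F (Fin m)) :
    ∃ M : ℝ, ∀ (c : (Fin m → AdeleRing (𝓞 F) F) → ℂ), (∀ x, ‖c x‖ ≤ 1) → ∀ q : G ⧸ Γ,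
      ‖orbitSumQuot F Γ A hΓ (fun x => Φ x * c x) q‖ ≤ M := by
  obtain ⟨C, hC, hcov⟩ := Literature.MeasureTheory.Group.WeilQuotient.exists_isCompact_image_mk_superset (H := Γ)
    (isCompact_univ : IsCompact (Set.univ : Set (G ⧸ Γ)))
  obtain ⟨u, hu, hle⟩ := exists_summable_majorant_of_isCompact A hA hΦ hC
  refine ⟨∑' ξ : Fin m → F, u ξ, fun c hc q => ?_⟩
  obtain ⟨g, hg, hgq⟩ := hcov (Set.mem_univ q)
  rw [← hgq, orbitSumQuot_mk]
  refine (norm_orbitSum_mul_le_tsum F A hΦ c hc g).trans ?_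
  exact (summable_norm_apply_ratPt A hΦ g).tsum_le_tsum (fun ξ => hle ξ g hg) hu

omit [TopologicalSpace G] [IsTopologicalGroup G] [LocallyCompactSpace G] [CompactSpace (G ⧸ Γ)] [MeasurableSpace (G ⧸ Γ)]
  [BorelSpace (G ⧸ Γ)] in
/-- **Tannery in the fibre**: along cut-offs `c_k → 1` with `|c_k| ≤ 1`, `orbitSum (Φ·c_k) g → orbitSum Φ g`.
[cite: Weil1965, Chap. I n° 2, Lemme 5, p. 9] -/
theorem tendsto_orbitSum_mul {Φ : (Fin m → AdeleRing (𝓞 F) F) → ℂ} (hΦ : Φ ∈ piSchwartzBruhat F (Fin m)) (c : ℕ → (Fin m → AdeleRing (𝓞 F) F) → ℂ)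
    (hc : ∀ k x, ‖c k x‖ ≤ 1) (hlim : ∀ x, Tendsto (fun k => c k x) atTop (𝓝 1)) (g : G) :
    Tendsto (fun k => orbitSum F A (fun x => Φ x * c k x) g) atTop (𝓝 (orbitSum F A Φ g)) := by
  unfold orbitSum
  have h := tendsto_tsum_of_dominated_convergence (𝓕 := atTop)
    (f := fun k (ξ : NonzeroRat F m) => Φ (A g (ratPt F (Fin m) (ξ : Fin m → F))) * c k (A g (ratPt F (Fin m) (ξ : Fin m → F))))
    (g := fun ξ : NonzeroRat F m => Φ (A g (ratPt F (Fin m) (ξ : Fin m → F))))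
    (bound := fun ξ : NonzeroRat F m => ‖Φ (A g (ratPt F (Fin m) (ξ : Fin m → F)))‖)
    (summable_norm_orbitSum_term A hΦ g) (fun ξ => by
      simpa only [mul_one] using (tendsto_const_nhds.mul (hlim (A g (ratPt F (Fin m) (ξ : Fin m → F))))))
    (Eventually.of_forall fun k ξ => by
      rw [norm_mul]
      exact mul_le_of_le_one_right (norm_nonneg _) (hc k _))
  exact h

include hA in
/-- **CUT-OFF CONTINUITY OF THE ORBIT FUNCTIONAL**: for `Φ ∈ 𝒮(𝔸_F^m)` and Schwartz–Bruhat cut-offs `c_k` with `|c_k| ≤ 1`,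
`c_k → 1` pointwise, `Λ(Φ·c_k) → Λ(Φ)` (dominated convergence on the compact quotient with the constant bound of
`exists_orbitSumQuot_mul_bound`). [cite: Weil1965, Chap. I n° 2, Lemme 5, p. 9] -/
theorem tendsto_orbitFunctional_mul (Φ : piSchwartzBruhat F (Fin m)) (c : ℕ → (Fin m → AdeleRing (𝓞 F) F) → ℂ)
    (hcS : ∀ k, (fun x => (Φ : (Fin m → AdeleRing (𝓞 F) F) → ℂ) x * c k x) ∈ piSchwartzBruhat F (Fin m))
    (hc : ∀ k x, ‖c k x‖ ≤ 1) (hlim : ∀ x, Tendsto (fun k => c k x) atTop (𝓝 1)) :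
    Tendsto (fun k => orbitFunctional F Γ ν A hA hΓ ⟨fun x => (Φ : (Fin m → AdeleRing (𝓞 F) F) → ℂ) x * c k x, hcS k⟩) atTop
      (𝓝 (orbitFunctional F Γ ν A hA hΓ Φ)) := by
  obtain ⟨M, hM⟩ := exists_orbitSumQuot_mul_bound F Γ A hA hΓ Φ.2
  simp only [orbitFunctional_apply]
  refine tendsto_integral_of_dominated_convergence (fun _ => M)
    (fun k => (continuous_orbitSumQuot F Γ A hA hΓ (hcS k)).aestronglyMeasurable) (integrable_const M)
    (fun k => Eventually.of_forall fun q => hM (c k) (hc k) q) (Eventually.of_forall fun q => ?_)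
  induction q using QuotientGroup.induction_on with
  | H g =>
    simp only [orbitSumQuot_mk]
    exact tendsto_orbitSum_mul F A Φ.2 c hc hlim g

include hA in
/-- **CUT-OFF CONTINUITY OF THE REAL ORBIT FUNCTIONAL** — the hypothesis `ht` of ★
`integral_schwartzBruhatMeasure_eq_of_tendsto_cutoff`: for `Ψ ∈ 𝒮_ℝ(𝔸_F^m)` and real Schwartz–Bruhat cut-offs
`c_k ∈ [0, 1]`, `c_k → 1` pointwise, `Λ_ℝ(Ψ c_k) → Λ_ℝ(Ψ)`.  Hence `∫ Ψ dν_{Λ_ℝ} = Λ_ℝ Ψ` for `Ψ ≥ 0`: the theta-side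
orbit functional IS (integration against) its Radon measure. [cite: Weil1965, Chap. I n° 2, Lemmes 3 and 5, pp. 7–9] -/
theorem tendsto_orbitFunctionalReal_mul (Ψ : piSchwartzBruhatReal F (Fin m)) (c : ℕ → (Fin m → AdeleRing (𝓞 F) F) → ℝ)
    (hcS : ∀ k, c k ∈ piSchwartzBruhatReal F (Fin m)) (hc01 : ∀ k x, c k x ∈ Set.Icc (0 : ℝ) 1)
    (hlim : ∀ x, Tendsto (fun k => c k x) atTop (𝓝 1)) :
    Tendsto (fun k => orbitFunctionalReal F Γ ν A hA hΓ
        ⟨(Ψ : (Fin m → AdeleRing (𝓞 F) F) → ℝ) * c k, mul_mem_piSchwartzBruhatReal Ψ.2 (hcS k)⟩) atTop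
      (𝓝 (orbitFunctionalReal F Γ ν A hA hΓ Ψ)) := by
  -- complexify: `ofRealSB (Ψ c_k) = (ofRealSB Ψ) · (c_k : ℂ)`
  have hcS' : ∀ k, (fun x => (ofRealSB F Ψ : (Fin m → AdeleRing (𝓞 F) F) → ℂ) x * ((c k x : ℝ) : ℂ)) ∈ piSchwartzBruhat F (Fin m) := fun k => by
    have h := (mul_mem_piSchwartzBruhatReal Ψ.2 (hcS k) : (Ψ : (Fin m → AdeleRing (𝓞 F) F) → ℝ) * c k ∈ piSchwartzBruhatReal F (Fin m))
    rw [mem_piSchwartzBruhatReal_iff] at h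
    convert h using 1
    funext x
    simp only [coe_ofRealSB, Pi.mul_apply, Complex.ofReal_mul]
  have hc' : ∀ k x, ‖((c k x : ℝ) : ℂ)‖ ≤ 1 := fun k x => by
    rw [Complex.norm_real, Real.norm_eq_abs, abs_le]
    exact ⟨by linarith [(hc01 k x).1], (hc01 k x).2⟩
  have hlim' : ∀ x, Tendsto (fun k => ((c k x : ℝ) : ℂ)) atTop (𝓝 1) := fun x => by
    have h := (Complex.continuous_ofReal.tendsto 1).comp (hlim x)
    rw [Complex.ofReal_one] at h
    exact h
  have h := tendsto_orbitFunctional_mul F Γ ν A hA hΓ (ofRealSB F Ψ) (fun k x => ((c k x : ℝ) : ℂ)) hcS' hc' hlim'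
  have hk : ∀ k, orbitFunctional F Γ ν A hA hΓ ⟨fun x => (ofRealSB F Ψ : (Fin m → AdeleRing (𝓞 F) F) → ℂ) x * ((c k x : ℝ) : ℂ), hcS' k⟩ =
      orbitFunctional F Γ ν A hA hΓ (ofRealSB F ⟨(Ψ : (Fin m → AdeleRing (𝓞 F) F) → ℝ) * c k, mul_mem_piSchwartzBruhatReal Ψ.2 (hcS k)⟩) :=
    fun k => congrArg _ (Subtype.ext (funext fun x => by
      simp only [coe_ofRealSB, Pi.mul_apply, Complex.ofReal_mul]))
  simp only [orbitFunctionalReal_apply]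
  refine (Complex.continuous_re.tendsto _).comp ?_
  refine h.congr fun k => ?_
  exact hk k

include hA in
/-- **THE ORBIT FUNCTIONAL IS ITS RADON MEASURE on `Ψ ≥ 0`**: `Ψ ∈ L¹(ν_{Λ_ℝ})` and `∫ Ψ dν_{Λ_ℝ} = Λ_ℝ(Ψ)` for every
`0 ≤ Ψ ∈ 𝒮_ℝ(𝔸_F^m)` — ★ `integral_schwartzBruhatMeasure_eq_of_tendsto_cutoff` fed with the tensor cut-offs of ★
`exists_tensor_cutoff` and `tendsto_orbitFunctionalReal_mul`. [cite: Weil1965, Chap. I n° 2, Lemmes 3 and 5, pp. 7–10] -/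
theorem integral_schwartzBruhatMeasure_orbitFunctionalReal_eq [MeasurableSpace (AdeleRing (𝓞 F) F)]
    [BorelSpace (AdeleRing (𝓞 F) F)] (Ψ : piSchwartzBruhatReal F (Fin m)) (hΨ : 0 ≤ (Ψ : (Fin m → AdeleRing (𝓞 F) F) → ℝ)) :
    Integrable (Ψ : (Fin m → AdeleRing (𝓞 F) F) → ℝ) (schwartzBruhatMeasure F (Fin m) (orbitFunctionalReal F Γ ν A hA hΓ)
        (orbitFunctionalReal_nonneg F Γ ν A hA hΓ)) ∧
      ∫ x, (Ψ : (Fin m → AdeleRing (𝓞 F) F) → ℝ) x ∂(schwartzBruhatMeasure F (Fin m) (orbitFunctionalReal F Γ ν A hA hΓ)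
        (orbitFunctionalReal_nonneg F Γ ν A hA hΓ)) = orbitFunctionalReal F Γ ν A hA hΓ Ψ := by
  obtain ⟨U, β, -, -, -, -, -, hcS, hc01, hcs, hev⟩ := exists_tensor_cutoff F (Fin m)
  exact integral_schwartzBruhatMeasure_eq_of_tendsto_cutoff F (Fin m) (orbitFunctionalReal F Γ ν A hA hΓ)
    (orbitFunctionalReal_nonneg F Γ ν A hA hΓ) Ψ hΨ _ hcS hc01 hcs
    (tendsto_orbitFunctionalReal_mul F Γ ν A hA hΓ Ψ _ hcS hc01 fun v =>
      tendsto_const_nhds.congr' ((hev v).mono fun n hn => hn.symm))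

end Cutoff

/-! ### §2 The dual-pair instance: `Λ_θ` of `(U(J_V), U(J_𝕎))` -/

section DualPair

open UnitaryDoubling

variable (F E : Type) [Field F] [NumberField F] [Field E] [NumberField E] [Algebra F E] [Algebra.IsQuadraticExtension F E]
  (c : E ≃ₐ[F] E) {δ : E} (hcδ : c δ = -δ) (hδ : δ ≠ 0) {d : F} (hd : δ * δ = algebraMap F E d)
  (N : ℕ) {n : ℕ} (e : Fin N × Fin 1 ≃ Fin n)
  (TV : Matrix (Fin N) (Fin N) F) (hV : TV.IsSymm) (hVd : IsUnit TV.det)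
  (TW : Matrix (Fin 1) (Fin 1) F) (hW : TW.IsSymm) (hWd : IsUnit TW.det)
  [LocallyCompactSpace (UnitaryGroup.adelic F E c N (TV.map (algebraMap F E)))]
  [CompactSpace (UnitaryGroup.adelic F E c N (TV.map (algebraMap F E)) ⧸ (UnitaryGroup.toAdelic F E c N (TV.map (algebraMap F E))).range)]
  [MeasurableSpace (UnitaryGroup.adelic F E c N (TV.map (algebraMap F E)) ⧸ (UnitaryGroup.toAdelic F E c N (TV.map (algebraMap F E))).range)]
  [BorelSpace (UnitaryGroup.adelic F E c N (TV.map (algebraMap F E)) ⧸ (UnitaryGroup.toAdelic F E c N (TV.map (algebraMap F E))).range)]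
  (ν : Measure (UnitaryGroup.adelic F E c N (TV.map (algebraMap F E)) ⧸ (UnitaryGroup.toAdelic F E c N (TV.map (algebraMap F E))).range)) [IsFiniteMeasure ν]

/-- **CUT-OFF CONTINUITY of `Λ_θ`** (the theta-side `ht` of ★ `integral_schwartzBruhatMeasure_eq_of_tendsto_cutoff` for the
dual pair): `Λ_θ,ℝ(Ψ c_k) → Λ_θ,ℝ(Ψ)` along real Schwartz–Bruhat cut-offs `c_k ∈ [0,1]`, `c_k → 1`.
[cite: Weil1965, Chap. I n° 2, Lemme 5, p. 9; n° 52] -/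
theorem tendsto_thetaOrbitFunctionalReal_mul (Ψ : piSchwartzBruhatReal F (Fin (n + n)))
    (cs : ℕ → (Fin (n + n) → AdeleRing (𝓞 F) F) → ℝ) (hcS : ∀ k, cs k ∈ piSchwartzBruhatReal F (Fin (n + n)))
    (hc01 : ∀ k x, cs k x ∈ Set.Icc (0 : ℝ) 1) (hlim : ∀ x, Tendsto (fun k => cs k x) atTop (𝓝 1)) :
    Tendsto (fun k => thetaOrbitFunctionalReal F E c hcδ hδ hd N e TV hV hVd TW hW hWd ν
        ⟨(Ψ : (Fin (n + n) → AdeleRing (𝓞 F) F) → ℝ) * cs k, mul_mem_piSchwartzBruhatReal Ψ.2 (hcS k)⟩) atTop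
      (𝓝 (thetaOrbitFunctionalReal F E c hcδ hδ hd N e TV hV hVd TW hW hWd ν Ψ)) :=
  tendsto_orbitFunctionalReal_mul F (UnitaryGroup.toAdelic F E c N (TV.map (algebraMap F E))).range ν
    (vDiagAct F E c hcδ hδ hd N e TV hV hVd TW hW hWd) (continuous_vDiagAct_apply F E c hcδ hδ hd N e TV hV hVd TW hW hWd)
    (vDiagAct_ratPt_of_mem F E c hcδ hδ hd N e TV hV hVd TW hW hWd) Ψ cs hcS hc01 hlim

/-- **`Λ_θ` IS ITS RADON MEASURE on `Ψ ≥ 0`**: for the dual pair `(U(J_V), U(J_𝕎))`, every `0 ≤ Ψ ∈ 𝒮_ℝ(X□(𝔸))` is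
`ν_{Λ_θ}`-integrable and `∫ Ψ dν_{Λ_θ} = Λ_θ,ℝ(Ψ)` — so the fibre measures `μ̂_b := ν_{Λ_θ}|_{hNorm⁻¹{b}}` (★ `fibreMeasure`)
recover `Λ_θ`. [cite: Weil1965, Chap. I n° 2, Lemmes 3 and 5, pp. 7–10; n° 52] -/
theorem integral_schwartzBruhatMeasure_thetaOrbitFunctionalReal_eq [MeasurableSpace (AdeleRing (𝓞 F) F)]
    [BorelSpace (AdeleRing (𝓞 F) F)] (Ψ : piSchwartzBruhatReal F (Fin (n + n)))
    (hΨ : 0 ≤ (Ψ : (Fin (n + n) → AdeleRing (𝓞 F) F) → ℝ)) :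
    Integrable (Ψ : (Fin (n + n) → AdeleRing (𝓞 F) F) → ℝ)
        (schwartzBruhatMeasure F (Fin (n + n)) (thetaOrbitFunctionalReal F E c hcδ hδ hd N e TV hV hVd TW hW hWd ν)
          (thetaOrbitFunctionalReal_nonneg F E c hcδ hδ hd N e TV hV hVd TW hW hWd ν)) ∧
      ∫ x, (Ψ : (Fin (n + n) → AdeleRing (𝓞 F) F) → ℝ) x
          ∂(schwartzBruhatMeasure F (Fin (n + n)) (thetaOrbitFunctionalReal F E c hcδ hδ hd N e TV hV hVd TW hW hWd ν)
            (thetaOrbitFunctionalReal_nonneg F E c hcδ hδ hd N e TV hV hVd TW hW hWd ν)) =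
        thetaOrbitFunctionalReal F E c hcδ hδ hd N e TV hV hVd TW hW hWd ν Ψ :=
  integral_schwartzBruhatMeasure_orbitFunctionalReal_eq F (UnitaryGroup.toAdelic F E c N (TV.map (algebraMap F E))).range ν
    (vDiagAct F E c hcδ hδ hd N e TV hV hVd TW hW hWd) (continuous_vDiagAct_apply F E c hcδ hδ hd N e TV hV hVd TW hW hWd)
    (vDiagAct_ratPt_of_mem F E c hcδ hδ hd N e TV hV hVd TW hW hWd) Ψ hΨ

end DualPair

end Literature.NumberTheory.Weil1965
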